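import Literature.Analysis.FluidPDE.NSViscosityRescaling
import Literature.Analysis.FluidPDE.ClassicalSolution
import HarnessLib

/-!
# Time dilation `v(s, x) = c u(c s, x)` of classical Navier–Stokes solutions: viscosity `ν ↦ c ν`,
# lifespan `T ↦ T/c`, maximality preserved (proved)

Analysis/FluidPDE support file (everything proved, no definitions), continuing
`NSViscosityRescaling` (Tao 2011, footnote 3: "One can of course generalise … to other viscosities
`ν > 0` by a simple rescaling argument"). That file proves the ONE-WAY normalisation
`IsClassicalNSSolutionOn.viscosityRescale_set` (viscosity `ν ↦ 1`, dilation factor `ν⁻¹`). To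
transport statements about MAXIMAL smooth solutions (`IsMaximalSmoothSolution`: classical on
`[0, T)` with no smooth extension past `T`, Beale–Kato–Majda's lifespan) between viscosities one
needs BOTH directions, i.e. the dilation with an arbitrary factor `c ≠ 0`:

* `IsClassicalNSSolutionOn.timeDilate_set` — if `(u, p)` solves the system with viscosity `ν` and
  force `f` classically on `S × E`, then `v = c u(c ·)`, `q = c² p(c ·)`, `g = c² f(c ·)`
  (`timeRescale c c u`, `timeRescale c (c²) p/f`) solve it with viscosity `c ν` on `S' × E`
  whenever `s ↦ c s` maps `S'` into `S` (`S'` of unique differentiability): multiply the momentum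
  equation at time `c s` by `c²` and use `∂ₛv = c²(∂ₜu)(cs)`, `(v·∇)v = c²(u·∇)u`, `Δv = cΔu`,
  `∇q = c²∇p`;
* (private) `timeRescale_inv_comp_timeRescale` — `c⁻¹`-dilation undoes `c`-dilation;
* `IsClassicalNSSolutionOn.timeDilate_Ico` — the half-open lifespan form `[0, T) ↦ [0, T/c)`,
  `c > 0`;
* `HasSmoothExtensionPast.timeDilate`, `hasSmoothExtensionPast_timeDilate_iff` — a smooth
  extension past `T` at viscosity `ν` is the same as a smooth extension of the dilated solution
  past `T/c` at viscosity `cν`;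
* `IsMaximalSmoothSolution.timeDilate` — maximality with lifespan `T` ↦ maximality with lifespan
  `T/c`; `IsMaximalSmoothSolution.toUnitViscosity` — the case `c = ν⁻¹`: a maximal smooth
  solution at viscosity `ν > 0` with lifespan `T` becomes one at viscosity `1` with lifespan `νT`.

## References

* T. Tao, *Localisation and compactness properties of the Navier–Stokes global regularity
  problem*, Anal. PDE 6 (2013) = arXiv:1108.1165, footnote 3 (p. 4). [Tao2011]
* J. T. Beale, T. Kato, A. Majda, Comm. Math. Phys. 94 (1984), §1 (the maximal interval of smooth
  existence). [BealeKatoMajda1984]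
-/

noncomputable section

open MeasureTheory Set Function Filter Topology InnerProductSpace
open scoped RealInnerProductSpace ENNReal NNReal Laplacian ContDiff

namespace Literature.Analysis.FluidPDE

variable {E : Type*} [NormedAddCommGroup E] [InnerProductSpace ℝ E] [FiniteDimensional ℝ E]

/-- **Time dilation of classical solutions, general factor (Tao 2011, footnote 3).** If `(u, p)`
solves `∂ₜu + (u·∇)u = νΔu − ∇p + f`, `div u = 0` classically on `S × E`, and `S'` is a set of
unique differentiability mapped into `S` by `s ↦ c s` (any real `c`; `c = 0` is the trivial case), then `v = c u(c ·)`, `q = c² p(c ·)`,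
`g = c² f(c ·)` solve the system with viscosity `c ν` classically on `S' × E`. (The case
`c = ν⁻¹` is `IsClassicalNSSolutionOn.viscosityRescale_set`.) [cite: Tao2011, footnote 3] -/
theorem IsClassicalNSSolutionOn.timeDilate_set {S S' : Set ℝ} {ν c : ℝ} {f u : ℝ → E → E}
    {p : ℝ → E → ℝ} (h : IsClassicalNSSolutionOn S ν f u p)
    (hS' : MapsTo (fun s => c * s) S' S) (hU : UniqueDiffOn ℝ S') :
    IsClassicalNSSolutionOn S' (c * ν) (timeRescale c (c ^ 2) f) (timeRescale c c u)
      (timeRescale c (c ^ 2) p) where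
  smooth_velocity := h.smooth_velocity.timeRescale _ _ hS'
  smooth_pressure := h.smooth_pressure.timeRescale _ _ hS'
  momentum s hs x := by
    have ht : c * s ∈ S := hS' hs
    set t : ℝ := c * s with htdef
    have hmom := h.momentum t ht x
    have hu2 : ContDiff ℝ 2 (u t) := (h.contDiff_velocity ht).of_le (by norm_cast)
    have hud : DifferentiableAt ℝ (u t) x := (hu2.differentiable (by norm_num)) x
    have hpd : DifferentiableAt ℝ (p t) x :=
      ((h.contDiff_pressure ht).differentiable (by simp)) x
    have hlap : (Δ fun y => c • u t y) x = c • (Δ (u t)) x := by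
      rw [show (fun y => c • u t y) = c • u t from rfl]
      exact laplacian_smul c hu2.contDiffAt
    rw [timeDerivWithin_timeRescale h.smooth_velocity c hS' hU hs x, timeRescale_slice,
      timeRescale_slice, timeRescale_apply, convect_const_smul_const_smul hud,
      hlap, gradient_const_smul hpd, ← htdef]
    have key : (c * c) • (timeDerivWithin S u t x + convect (u t) (u t) x) =
        (c * c) • (ν • (Δ (u t)) x - gradient (p t) x + f t x) := by rw [hmom]
    rw [smul_add] at key
    rw [key, smul_add, smul_sub, smul_smul, smul_smul, sq]
    congr 2
    ring
  divFree s hs := by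
    rw [timeRescale_slice]
    have ht : c * s ∈ S := hS' hs
    exact (h.divFree _ ht).const_smul ((h.contDiff_velocity ht).differentiable (by simp)) _

/-- The `c⁻¹`-dilation undoes the `c`-dilation: `timeRescale c⁻¹ a' (timeRescale c a w) = w` when
`a' a = 1` and `c ≠ 0`. [folklore] -/
private theorem timeRescale_inv_comp_timeRescale {X : Type*} {F : Type*} [NormedAddCommGroup F] [NormedSpace ℝ F]
    {c a a' : ℝ} (hc : c ≠ 0) (ha : a' * a = 1) (w : ℝ → X → F) :
    timeRescale c⁻¹ a' (timeRescale c a w) = w := by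
  funext s x
  simp only [timeRescale_apply, smul_smul, ha, one_smul, ← mul_assoc, mul_inv_cancel₀ hc, one_mul]

/-- `s ↦ c s` maps `[0, T/c)` into `[0, T)` for `c > 0`. [folklore] -/
private theorem mapsTo_const_mul_Ico_div {c : ℝ} (hc : 0 < c) (T : ℝ) :
    MapsTo (fun s => c * s) (Ico 0 (T / c)) (Ico 0 T) := by
  intro s hs
  refine ⟨mul_nonneg hc.le hs.1, ?_⟩
  have := hs.2
  rw [lt_div_iff₀ hc] at this
  linarith [mul_comm c s]

/-- **Time dilation on the half-open lifespan**: a classical solution with viscosity `ν` on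
`[0, T) × E` dilates by `c > 0` to one with viscosity `c ν` on `[0, T/c) × E`. [cite: Tao2011, footnote 3] -/
theorem IsClassicalNSSolutionOn.timeDilate_Ico {T ν c : ℝ} {f u : ℝ → E → E} {p : ℝ → E → ℝ}
    (h : IsClassicalNSSolutionOn (Ico 0 T) ν f u p) (hc : 0 < c) :
    IsClassicalNSSolutionOn (Ico 0 (T / c)) (c * ν) (timeRescale c (c ^ 2) f) (timeRescale c c u)
      (timeRescale c (c ^ 2) p) :=
  h.timeDilate_set (mapsTo_const_mul_Ico_div hc T) (uniqueDiffOn_Ico _ _)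

/-- **A smooth extension dilates**: if `u` extends smoothly past `T` at viscosity `ν` (force `f`),
then `c u(c ·)` extends smoothly past `T/c` at viscosity `c ν` (force `c² f(c ·)`), `c > 0`.
[cite: BealeKatoMajda1984, §1] -/
theorem HasSmoothExtensionPast.timeDilate {T ν c : ℝ} {f u : ℝ → E → E}
    (h : HasSmoothExtensionPast ν f u T) (hc : 0 < c) :
    HasSmoothExtensionPast (c * ν) (timeRescale c (c ^ 2) f) (timeRescale c c u) (T / c) := by
  obtain ⟨T', hT', u', p', hcl, hagree⟩ := h
  refine ⟨T' / c, div_lt_div_of_pos_right hT' hc, timeRescale c c u', timeRescale c (c ^ 2) p',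
    hcl.timeDilate_Ico hc, fun s hs => ?_⟩
  rw [timeRescale_slice, timeRescale_slice, hagree (c * s) (mapsTo_const_mul_Ico_div hc T hs)]

/-- **Smooth extendability is invariant under time dilation** (`c > 0`): `u` extends smoothly past
`T` at viscosity `ν` iff `c u(c ·)` extends smoothly past `T/c` at viscosity `c ν`. [cite: BealeKatoMajda1984, §1] -/
theorem hasSmoothExtensionPast_timeDilate_iff {T ν c : ℝ} {f u : ℝ → E → E} (hc : 0 < c) :
    HasSmoothExtensionPast (c * ν) (timeRescale c (c ^ 2) f) (timeRescale c c u) (T / c) ↔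
      HasSmoothExtensionPast ν f u T := by
  refine ⟨fun h => ?_, fun h => h.timeDilate hc⟩
  have h' := h.timeDilate (inv_pos.2 hc)
  have hcc : c⁻¹ * (c * ν) = ν := by rw [← mul_assoc, inv_mul_cancel₀ hc.ne', one_mul]
  have hT : T / c / c⁻¹ = T := by rw [div_div, mul_inv_cancel₀ hc.ne', div_one]
  have hsq : c⁻¹ ^ 2 * c ^ 2 = 1 := by rw [← mul_pow, inv_mul_cancel₀ hc.ne', one_pow]
  rwa [hcc, hT, timeRescale_inv_comp_timeRescale hc.ne' hsq,
    timeRescale_inv_comp_timeRescale hc.ne' (inv_mul_cancel₀ hc.ne')] at h'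

/-- **Maximality dilates** (`c > 0`): a maximal smooth solution with lifespan `T` at viscosity `ν`
becomes, under `v = c u(c ·)`, `q = c² p(c ·)`, a maximal smooth solution with lifespan `T/c` at
viscosity `c ν`. [cite: BealeKatoMajda1984, §1] -/
theorem IsMaximalSmoothSolution.timeDilate {T ν c : ℝ} {f u : ℝ → E → E} {p : ℝ → E → ℝ}
    (h : IsMaximalSmoothSolution ν f u p T) (hc : 0 < c) :
    IsMaximalSmoothSolution (c * ν) (timeRescale c (c ^ 2) f) (timeRescale c c u)
      (timeRescale c (c ^ 2) p) (T / c) :=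
  ⟨h.1.timeDilate_Ico hc, fun hext => h.2 ((hasSmoothExtensionPast_timeDilate_iff hc).1 hext)⟩

/-- **Normalisation to unit viscosity of a maximal smooth solution** (the case `c = ν⁻¹`): a
maximal smooth unforced solution at viscosity `ν > 0` with lifespan `T` yields the maximal smooth
unforced solution `v(s, x) = ν⁻¹u(s/ν, x)`, `q = ν⁻²p(s/ν, ·)` at viscosity `1` with lifespan
`νT`. [cite: Tao2011, footnote 3] -/
theorem IsMaximalSmoothSolution.toUnitViscosity {T ν : ℝ} {u : ℝ → E → E} {p : ℝ → E → ℝ}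
    (h : IsMaximalSmoothSolution ν 0 u p T) (hν : 0 < ν) :
    IsMaximalSmoothSolution 1 0 (timeRescale ν⁻¹ ν⁻¹ u) (timeRescale ν⁻¹ (ν⁻¹ ^ 2) p) (ν * T) := by
  have h' := h.timeDilate (inv_pos.2 hν)
  have h1 : ν⁻¹ * ν = 1 := inv_mul_cancel₀ hν.ne'
  have h2 : T / ν⁻¹ = ν * T := by rw [div_inv_eq_mul, mul_comm]
  rwa [h1, h2, timeRescale_zero_force] at h'

end Literature.Analysis.FluidPDE

end
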